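import Summits.BirchSwinnertonDyer.BirchSwinnertonDyer.Theses.InertQuadraticUntwist
import HarnessLib

/-! # Birth skeleton (BC3) for crux `Summit.BirchSwinnertonDyer.BirchSwinnertonDyer.Theses.InertQuadraticUntwist.TprimeThetaUpperHalfAtThree` of route InertQuadraticUntwist
(planner bsd-wall-pss3 g12, 2026-08-28; v2 = pss3 g15 fix of `skeleton.extra-hypothesis`: the composition is a CLOSED theorem over the
declared stubs, stub statements unchanged). Sorries ONLY inside `stub_*`; `TprimeThetaUpperHalfAtThree_of` concludes the route decl by name. -/

set_option linter.dupNamespace false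
set_option autoImplicit false

noncomputable section

open scoped Classical

open WeierstrassCurve CongruenceSubgroup
  Literature.NumberTheory.EllipticCurves
  Literature.NumberTheory.EllipticCurves.ModularForms
  Literature.NumberTheory.EllipticCurves.Rank1Residual
  Literature.NumberTheory.IwasawaTheory
open Summit.BirchSwinnertonDyer.BirchSwinnertonDyer.Theses.InertQuadraticUntwist

namespace Summit.BirchSwinnertonDyer.BirchSwinnertonDyer.Cruxes.TprimeThetaUpperHalfAtThree.Birth

/-! ## BC3 skeleton of `TprimeThetaUpperHalfAtThree`: split by the mod-3 image (onto rows: Kato (12.5.2) available; non-onto rows: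
the barrier `EulerSystemBigImageAtSmallImage` regime, separate input). -/

/-- stub / BC5 plan-only rung (thetaUpper, ONTO rows `Surj W 3`). -/
theorem stub_thetaUpper_surj :
    ∀ (W : WeierstrassCurve ℚ) [W.IsElliptic] [W.IsGloballyMinimal],
    ¬ W.HasCM → Addv W 3 → Summit.BirchSwinnertonDyer.Rank1Residual.Additive.SubTprime W 3 →
      W.analyticRank = 1 →
      Literature.NumberTheory.EllipticCurves.Rank1Residual.Surj W 3 →
      (∃ μ : (n : ℕ) → ZMod (3 ^ n) → ℂ_[3],
        ∃ (N : ℕ) (_ : NeZero N) (f : CuspForm (Gamma0 N) 2), IsNewformOf W f ∧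
          IsGammaDistribution 3 μ ∧ HasGrowthOrder 3 (1 / 2) μ ∧
          ∃ (e : ℕ → ℂ_[3]) (κ₀ κ₁ ρ : ℝ), 0 < κ₀ ∧ 0 < κ₁ ∧ 1 ≤ ρ ∧
            (∀ m : ℕ, ‖e m‖ = (if Even m then κ₀ else κ₁) * ρ ^ m) ∧
            ∀ (m : ℕ) (ξ : DirichletCharacter ℂ_[3] (3 ^ m)), ξ.IsPrimitive → ξ.Even →
              (∃ j : ℕ, orderOf ξ = 3 ^ j) →
                gammaCharValue 3 μ ξ = e m * ratTwistedSymbolSum f ξ) →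
      Typed.MissingUpperBoundAt W 3 := by
  sorry

/-- stub (thetaUpper, NON-onto rows `¬ Surj W 3`). -/
theorem stub_thetaUpper_nonsurj :
    ∀ (W : WeierstrassCurve ℚ) [W.IsElliptic] [W.IsGloballyMinimal],
    ¬ W.HasCM → Addv W 3 → Summit.BirchSwinnertonDyer.Rank1Residual.Additive.SubTprime W 3 →
      W.analyticRank = 1 →
      ¬ Literature.NumberTheory.EllipticCurves.Rank1Residual.Surj W 3 →
      (∃ μ : (n : ℕ) → ZMod (3 ^ n) → ℂ_[3],
        ∃ (N : ℕ) (_ : NeZero N) (f : CuspForm (Gamma0 N) 2), IsNewformOf W f ∧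
          IsGammaDistribution 3 μ ∧ HasGrowthOrder 3 (1 / 2) μ ∧
          ∃ (e : ℕ → ℂ_[3]) (κ₀ κ₁ ρ : ℝ), 0 < κ₀ ∧ 0 < κ₁ ∧ 1 ≤ ρ ∧
            (∀ m : ℕ, ‖e m‖ = (if Even m then κ₀ else κ₁) * ρ ^ m) ∧
            ∀ (m : ℕ) (ξ : DirichletCharacter ℂ_[3] (3 ^ m)), ξ.IsPrimitive → ξ.Even →
              (∃ j : ℕ, orderOf ξ = 3 ^ j) →
                gammaCharValue 3 μ ξ = e m * ratTwistedSymbolSum f ξ) →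
      Typed.MissingUpperBoundAt W 3 := by
  sorry

/-- COMPOSITION (line `birth` v2, kernel-checked, CLOSED over the declared stubs — v1's `_of` took the two
stub statements as raw `∀`-binders `(h₁ …) (h₂ …)`, which the skeleton audit reads as `skeleton.extra-hypothesis`):
the route crux `TprimeThetaUpperHalfAtThree` BY NAME (type literally the route decl) from `stub_thetaUpper_surj` /
`stub_thetaUpper_nonsurj` by the case split on the mod-3 image `Surj W 3` (pure logic). -/
theorem TprimeThetaUpperHalfAtThree_of :
    Summit.BirchSwinnertonDyer.BirchSwinnertonDyer.Theses.InertQuadraticUntwist.TprimeThetaUpperHalfAtThree := by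
  intro W _ _ hCM hadd ht hr hμ
  by_cases hs : Literature.NumberTheory.EllipticCurves.Rank1Residual.Surj W 3
  · exact stub_thetaUpper_surj W hCM hadd ht hr hs hμ
  · exact stub_thetaUpper_nonsurj W hCM hadd ht hr hs hμ

end Summit.BirchSwinnertonDyer.BirchSwinnertonDyer.Cruxes.TprimeThetaUpperHalfAtThree.Birth

end
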